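import Summits.ResolutionOfSingularities.ResolutionOfSingularities.Theorems.WildQuotientsSummitReductionStubPairOrbitNormalFormBlowupChartsOverCentreElim
import Summits.ResolutionOfSingularities.ResolutionOfSingularities.Theorems.WildQuotientsSummitReductionStubPairOrbitNormalFormBlowupChartsOverCentreRsop
import HarnessLib

/-!
# `WildQuotients.SummitReduction` (stmt-ResolutionOfSingularities-16324), line `FramePerfect`, stub O3
# (`stub_pair_orbitNormalFormBlowup_chartsOverCentre`): the chart "`u ≠ 0`" at the closed points
# over the closed point, and the regular case in general position

Route `ResolutionOfSingularities/WildQuotients`, crux `SummitReduction`; helper file of stub O3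
(de Jong 1996, 4.27 [C2] on the coefficient-free model). For `R` regular local with a regular
system of parameters `(c, w)`, `c` the centre, `S` further branches among the `w`, the strict
transform of `c₀c₁ - c₂c₃ ∏_{k ∈ S} w_k` on the chart `R[𝔓/c₀]` is
`f = c₁/c₀ - (c₂/c₀)(c₃/c₀) ∏_{k ∈ S} w_k` (de Jong 1996, p. 76: "`v' - t₁'t₂'t₃ ⋯ t_s = 0`.
Clearly, this is smooth"). PROVED here, at every CLOSED point `𝔔` over the closed point:

* `chartsOverCentre_chartX` — a part of a regular system of parameters of `R[𝔓/c₀]_𝔔` starting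
  with `f` and containing `c₀`, and exponents (`2` on `c₀`, `≤ 1` elsewhere) exhibiting the
  boundary `c₂c₃ ∏_{k ∈ T} w_k` as a unit times a monomial;
* `chartsOverCentre_regularCase''` — the regular case read off from such a marked family.

## Sources

* A. J. de Jong, *Smoothness, semi-stability and alterations*, Publ. Math. IHÉS 83 (1996), 4.27,
  p. 76. [DeJong1996]
-/

set_option linter.dupNamespace false -- the tree's summit namespace repeats `ResolutionOfSingularities`

noncomputable section

open IsLocalRing
open Literature.AlgebraicGeometry.Resolution

namespace Summit.ResolutionOfSingularities.ResolutionOfSingularities.Theorems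

/-- Exchanging a generator modulo the rest. [folklore] -/
theorem chartsOverCentre_span_singleton_sup_eq_of_sub_mem {S : Type} [CommRing S] {x y : S}
    {K : Ideal S} (h : x - y ∈ K) : Ideal.span {x} ⊔ K = Ideal.span {y} ⊔ K :=
  le_antisymm (sup_le (by
      rw [Ideal.span_singleton_le_iff_mem, show x = y + (x - y) by ring]
      exact Ideal.add_mem _ (Ideal.mem_sup_left (Ideal.mem_span_singleton_self y))
        (Ideal.mem_sup_right h)) le_sup_right)
    (sup_le (by
      rw [Ideal.span_singleton_le_iff_mem, show y = x - (x - y) by ring]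
      exact Ideal.sub_mem _ (Ideal.mem_sup_left (Ideal.mem_span_singleton_self x))
        (Ideal.mem_sup_right h)) le_sup_right)

/-- **Chart "`u ≠ 0`"** (de Jong 1996, 4.27: "Here we have coordinates `u, v, t₁, …, t_{d-1},
v', t₁', t₂'` and equations `v = uv'`, `t₁ = ut₁'`, `t₂ = ut₂'` and `v' - t₁'t₂'t₃ ⋯ t_s = 0`.
Clearly, this is smooth and `Z` is given by `ut₁'t₂'t₃ ⋯ t_r = 0`, a normal crossings divisor"),
coefficient-free, at a CLOSED point of the chart `D₊(c₀)` over the closed point: with the strict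
transform `f = c₁/c₀ - (c₂/c₀)(c₃/c₀) ∏_{k ∈ S} w_k` at the maximal `𝔔`, there is a part
`(f, c₀, (c_m/c₀)_{m ∈ J}, w)` of a regular system of parameters of `R[𝔓/c₀]_𝔔` and exponents
(`2` on `c₀`, `1` on the `c_m/c₀ ∈ 𝔔`, `m ∈ {2, 3}`, and on the `w_k`, `k ∈ T`, `0` elsewhere)
exhibiting the boundary `c₂c₃ ∏_{k ∈ T} w_k` as a unit times the corresponding monomial (the
`c_m/c₀ ∉ 𝔔` being units). At the points with `c₁/c₀ ∉ 𝔔` (then all `c_m/c₀` are units and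
`S = ∅`) this is `chartsOverCentre_isRsopPart_cons_elim`. [cite: DeJong1996, 4.27, p. 76] -/
theorem chartsOverCentre_chartX {R : Type} [CommRing R] [IsRegularLocalRing R]
    (c : Fin 4 → R) {l : ℕ} (w : Fin l → R)
    (hz : Ideal.span (Set.range (Fin.append c w)) = maximalIdeal R)
    (hd : (maximalIdeal R).spanFinrank = 4 + l)
    (𝔓 : Ideal R) (h𝔓 : 𝔓 = Ideal.span (Set.range c)) (hc : ∀ k, c k ∈ 𝔓)
    (S T : Finset (Fin l))
    (𝔔 : Ideal (blowupAlgebra 𝔓 (c 0))) [𝔔.IsMaximal]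
    (h𝔔 : 𝔔.comap (algebraMap R _) = maximalIdeal R)
    (L : Type) [CommRing L] [IsLocalRing L] [Algebra (blowupAlgebra 𝔓 (c 0)) L]
    [IsLocalization.AtPrime L 𝔔]
    (hf : blowupAlgebra.gen 𝔓 (c 0) (c 0) (hc 0) * blowupAlgebra.gen 𝔓 (c 0) (c 1) (hc 1) -
      blowupAlgebra.gen 𝔓 (c 0) (c 2) (hc 2) * blowupAlgebra.gen 𝔓 (c 0) (c 3) (hc 3) *
        algebraMap R (blowupAlgebra 𝔓 (c 0)) (∏ k ∈ S, w k) ∈ 𝔔) :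
    ∃ (a : ℕ) (jJ : Fin a → {k : Fin 4 // k ≠ 0}) (ex : Fin (a + l + 1) → ℕ) (U : L),
      IsRsopPart (Fin.cons (algebraMap (blowupAlgebra 𝔓 (c 0)) L
        (blowupAlgebra.gen 𝔓 (c 0) (c 0) (hc 0) * blowupAlgebra.gen 𝔓 (c 0) (c 1) (hc 1) -
          blowupAlgebra.gen 𝔓 (c 0) (c 2) (hc 2) * blowupAlgebra.gen 𝔓 (c 0) (c 3) (hc 3) *
            algebraMap R (blowupAlgebra 𝔓 (c 0)) (∏ k ∈ S, w k)))
        (chartFamily c 0 w L (algebraMap R (blowupAlgebra 𝔓 (c 0)))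
          (fun k => blowupAlgebra.gen 𝔓 (c 0) (c k) (hc k)) jJ) : Fin (a + l + 1 + 1) → L) ∧
      ex 0 = 2 ∧ (∀ i, i ≠ 0 → ex i ≤ 1) ∧ IsUnit U ∧
      algebraMap (blowupAlgebra 𝔓 (c 0)) L (algebraMap R _ (c 2 * c 3 * ∏ k ∈ T, w k)) -
        U * ∏ i, chartFamily c 0 w L (algebraMap R (blowupAlgebra 𝔓 (c 0)))
          (fun k => blowupAlgebra.gen 𝔓 (c 0) (c k) (hc k)) jJ i ^ ex i ∈
        Ideal.span {algebraMap (blowupAlgebra 𝔓 (c 0)) L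
          (blowupAlgebra.gen 𝔓 (c 0) (c 0) (hc 0) * blowupAlgebra.gen 𝔓 (c 0) (c 1) (hc 1) -
            blowupAlgebra.gen 𝔓 (c 0) (c 2) (hc 2) * blowupAlgebra.gen 𝔓 (c 0) (c 3) (hc 3) *
              algebraMap R (blowupAlgebra 𝔓 (c 0)) (∏ k ∈ S, w k))} := by
  classical
  have he0 : blowupAlgebra.gen 𝔓 (c 0) (c 0) (hc 0) = 1 := blowupAlgebra.gen_self 𝔓 (c 0) (hc 0)
  have hcm : ∀ m, algebraMap R (blowupAlgebra 𝔓 (c 0)) (c m) = blowupAlgebra.gen 𝔓 (c 0) (c m) (hc m) * algebraMap R (blowupAlgebra 𝔓 (c 0)) (c 0) := fun m =>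
    (blowupAlgebra.gen_mul_algebraMap 𝔓 (c 0) (c m) (hc m)).symm
  have hJL : algebraMap (blowupAlgebra 𝔓 (c 0)) L (algebraMap R (blowupAlgebra 𝔓 (c 0)) (c 2 * c 3 * ∏ k ∈ T, w k)) =
      algebraMap (blowupAlgebra 𝔓 (c 0)) L (algebraMap R (blowupAlgebra 𝔓 (c 0)) (c 0)) ^ 2 * algebraMap (blowupAlgebra 𝔓 (c 0)) L (blowupAlgebra.gen 𝔓 (c 0) (c 2) (hc 2)) * algebraMap (blowupAlgebra 𝔓 (c 0)) L (blowupAlgebra.gen 𝔓 (c 0) (c 3) (hc 3)) * ∏ k ∈ T, algebraMap (blowupAlgebra 𝔓 (c 0)) L (algebraMap R (blowupAlgebra 𝔓 (c 0)) (w k)) := by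
    simp only [map_mul, map_prod]
    rw [hcm 2, hcm 3]
    simp only [map_mul]
    ring
  have hwk : ∀ k, algebraMap R (blowupAlgebra 𝔓 (c 0)) (w k) ∈ 𝔔 := fun k => map_w_mem c w hz (algebraMap R (blowupAlgebra 𝔓 (c 0))) 𝔔 h𝔔 k
  have hunit : ∀ m, blowupAlgebra.gen 𝔓 (c 0) (c m) (hc m) ∉ 𝔔 →
      IsUnit (algebraMap (blowupAlgebra 𝔓 (c 0)) L (blowupAlgebra.gen 𝔓 (c 0) (c m) (hc m))) := fun m hm =>
    IsLocalization.map_units L (⟨blowupAlgebra.gen 𝔓 (c 0) (c m) (hc m), hm⟩ : 𝔔.primeCompl)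
  -- the product of the family with the exponents, generically
  have hprodZ : ∀ {a : ℕ} (jJ : Fin a → {k : Fin 4 // k ≠ 0}) (ε : Fin a → ℕ),
      ∏ i, chartFamily c 0 w L (algebraMap R (blowupAlgebra 𝔓 (c 0))) (fun k => blowupAlgebra.gen 𝔓 (c 0) (c k) (hc k)) jJ i ^
        (Fin.cons 2 (Fin.append ε fun k => if k ∈ T then 1 else 0) : Fin (a + l + 1) → ℕ) i =
      algebraMap (blowupAlgebra 𝔓 (c 0)) L (algebraMap R (blowupAlgebra 𝔓 (c 0)) (c 0)) ^ 2 * (∏ t, algebraMap (blowupAlgebra 𝔓 (c 0)) L (blowupAlgebra.gen 𝔓 (c 0) (c (jJ t).1) (hc _)) ^ ε t) *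
        ∏ k ∈ T, algebraMap (blowupAlgebra 𝔓 (c 0)) L (algebraMap R (blowupAlgebra 𝔓 (c 0)) (w k)) := by
    intro a jJ ε
    have hQ : ∏ k, algebraMap (blowupAlgebra 𝔓 (c 0)) L (algebraMap R (blowupAlgebra 𝔓 (c 0)) (w k)) ^ (if k ∈ T then 1 else 0) = ∏ k ∈ T, algebraMap (blowupAlgebra 𝔓 (c 0)) L (algebraMap R (blowupAlgebra 𝔓 (c 0)) (w k)) := by
      rw [← Finset.prod_filter_of_ne (s := Finset.univ) (p := fun k => k ∈ T) (fun k _ hk => ?_)]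
      · rw [Finset.filter_mem_eq_inter, Finset.univ_inter]
        exact Finset.prod_congr rfl fun k hk => by rw [if_pos hk, pow_one]
      · by_contra hkT
        rw [if_neg hkT, pow_zero] at hk
        exact hk rfl
    rw [Fin.prod_univ_succ]
    simp only [chartFamily, Fin.cons_zero, Fin.cons_succ]
    rw [Fin.prod_univ_add]
    simp only [Fin.append_left, Fin.append_right]
    rw [hQ]
    ring
  by_cases h1 : blowupAlgebra.gen 𝔓 (c 0) (c 1) (hc 1) ∈ 𝔔
  swap
  · -- the points with `c₁/c₀` invertible: all of `c_m/c₀` are units and `S = ∅`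
    have hf' : blowupAlgebra.gen 𝔓 (c 0) (c 1) (hc 1) - blowupAlgebra.gen 𝔓 (c 0) (c 2) (hc 2) * blowupAlgebra.gen 𝔓 (c 0) (c 3) (hc 3) * algebraMap R (blowupAlgebra 𝔓 (c 0)) (∏ k ∈ S, w k) ∈ 𝔔 := by
      have : blowupAlgebra.gen 𝔓 (c 0) (c 0) (hc 0) * blowupAlgebra.gen 𝔓 (c 0) (c 1) (hc 1) - blowupAlgebra.gen 𝔓 (c 0) (c 2) (hc 2) * blowupAlgebra.gen 𝔓 (c 0) (c 3) (hc 3) * algebraMap R (blowupAlgebra 𝔓 (c 0)) (∏ k ∈ S, w k) = blowupAlgebra.gen 𝔓 (c 0) (c 1) (hc 1) - blowupAlgebra.gen 𝔓 (c 0) (c 2) (hc 2) * blowupAlgebra.gen 𝔓 (c 0) (c 3) (hc 3) * algebraMap R (blowupAlgebra 𝔓 (c 0)) (∏ k ∈ S, w k) := by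
        rw [he0, one_mul]
      rw [← this]; exact hf
    have h23H : blowupAlgebra.gen 𝔓 (c 0) (c 2) (hc 2) * blowupAlgebra.gen 𝔓 (c 0) (c 3) (hc 3) * algebraMap R (blowupAlgebra 𝔓 (c 0)) (∏ k ∈ S, w k) ∉ 𝔔 := fun h => h1 (by simpa using 𝔔.add_mem hf' h)
    have h2 : blowupAlgebra.gen 𝔓 (c 0) (c 2) (hc 2) ∉ 𝔔 := fun h => h23H (by rw [mul_assoc]; exact 𝔔.mul_mem_right _ h)
    have h3 : blowupAlgebra.gen 𝔓 (c 0) (c 3) (hc 3) ∉ 𝔔 := fun h => h23H (by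
      rw [mul_comm (blowupAlgebra.gen 𝔓 (c 0) (c 2) (hc 2)), mul_assoc]; exact 𝔔.mul_mem_right _ h)
    have hS : S = ∅ := by
      by_contra hne
      obtain ⟨k, hk⟩ := Finset.nonempty_iff_ne_empty.mpr hne
      apply h23H
      obtain ⟨q, hq⟩ : w k ∣ (∏ k ∈ S, w k) := Finset.dvd_prod_of_mem _ hk
      have : blowupAlgebra.gen 𝔓 (c 0) (c 2) (hc 2) * blowupAlgebra.gen 𝔓 (c 0) (c 3) (hc 3) * algebraMap R (blowupAlgebra 𝔓 (c 0)) (∏ k ∈ S, w k) = algebraMap R (blowupAlgebra 𝔓 (c 0)) (w k) * (blowupAlgebra.gen 𝔓 (c 0) (c 2) (hc 2) * blowupAlgebra.gen 𝔓 (c 0) (c 3) (hc 3) * algebraMap R (blowupAlgebra 𝔓 (c 0)) q) := by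
        rw [hq, map_mul]; ring
      rw [this]
      exact 𝔔.mul_mem_right _ (hwk k)
    have hH1 : algebraMap R (blowupAlgebra 𝔓 (c 0)) (∏ k ∈ S, w k) = 1 := by rw [hS, Finset.prod_empty, map_one]
    have hfeq : blowupAlgebra.gen 𝔓 (c 0) (c 0) (hc 0) * blowupAlgebra.gen 𝔓 (c 0) (c 1) (hc 1) - blowupAlgebra.gen 𝔓 (c 0) (c 2) (hc 2) * blowupAlgebra.gen 𝔓 (c 0) (c 3) (hc 3) * algebraMap R (blowupAlgebra 𝔓 (c 0)) (∏ k ∈ S, w k) = blowupAlgebra.gen 𝔓 (c 0) (c 1) (hc 1) - blowupAlgebra.gen 𝔓 (c 0) (c 2) (hc 2) * blowupAlgebra.gen 𝔓 (c 0) (c 3) (hc 3) := by rw [he0, hH1]; ring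
    have hf'' : blowupAlgebra.gen 𝔓 (c 0) (c 1) (hc 1) - blowupAlgebra.gen 𝔓 (c 0) (c 2) (hc 2) * blowupAlgebra.gen 𝔓 (c 0) (c 3) (hc 3) ∈ 𝔔 := by rw [← hfeq]; exact hf
    have hrs := chartsOverCentre_isRsopPart_cons_elim c 0 w hz hd 𝔓 h𝔓 hc 𝔔 h𝔔 L
      ⟨1, by decide⟩ ⟨2, by decide⟩ ⟨3, by decide⟩ (by decide) (by decide) hf''
    refine ⟨0, Fin.elim0, Fin.cons 2 (Fin.append Fin.elim0 fun k => if k ∈ T then 1 else 0),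
      algebraMap (blowupAlgebra 𝔓 (c 0)) L (blowupAlgebra.gen 𝔓 (c 0) (c 2) (hc 2)) * algebraMap (blowupAlgebra 𝔓 (c 0)) L (blowupAlgebra.gen 𝔓 (c 0) (c 3) (hc 3)), ?_, rfl, fun i hi => ?_, (hunit 2 h2).mul (hunit 3 h3), ?_⟩
    · rw [hfeq]
      exact hrs
    · obtain ⟨i, rfl⟩ := Fin.exists_succ_eq.mpr hi
      rw [Fin.cons_succ]
      refine Fin.addCases (fun t => Fin.elim0 t) (fun k => ?_) i
      rw [Fin.append_right]
      split_ifs <;> omega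
    · rw [hprodZ, hJL]
      simp only [Finset.univ_eq_empty, Finset.prod_empty, mul_one]
      rw [show algebraMap (blowupAlgebra 𝔓 (c 0)) L (algebraMap R (blowupAlgebra 𝔓 (c 0)) (c 0)) ^ 2 * algebraMap (blowupAlgebra 𝔓 (c 0)) L (blowupAlgebra.gen 𝔓 (c 0) (c 2) (hc 2)) * algebraMap (blowupAlgebra 𝔓 (c 0)) L (blowupAlgebra.gen 𝔓 (c 0) (c 3) (hc 3)) * ∏ k ∈ T, algebraMap (blowupAlgebra 𝔓 (c 0)) L (algebraMap R (blowupAlgebra 𝔓 (c 0)) (w k)) -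
        algebraMap (blowupAlgebra 𝔓 (c 0)) L (blowupAlgebra.gen 𝔓 (c 0) (c 2) (hc 2)) * algebraMap (blowupAlgebra 𝔓 (c 0)) L (blowupAlgebra.gen 𝔓 (c 0) (c 3) (hc 3)) * (algebraMap (blowupAlgebra 𝔓 (c 0)) L (algebraMap R (blowupAlgebra 𝔓 (c 0)) (c 0)) ^ 2 * ∏ k ∈ T, algebraMap (blowupAlgebra 𝔓 (c 0)) L (algebraMap R (blowupAlgebra 𝔓 (c 0)) (w k))) = 0 by ring]
      exact Ideal.zero_mem _
  · -- the generic points: `c₁/c₀ ∈ 𝔔`; enumerate the `c_m/c₀ ∈ 𝔔`, `m ∈ {2, 3}`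
    set P : Finset {k : Fin 4 // k ≠ 0} :=
      ({⟨2, by decide⟩, ⟨3, by decide⟩} : Finset {k : Fin 4 // k ≠ 0}).filter
        (fun m => blowupAlgebra.gen 𝔓 (c 0) (c m.1) (hc m.1) ∈ 𝔔) with hP
    set a := P.card with ha
    let jJ : Fin a → {k : Fin 4 // k ≠ 0} := fun t => (P.orderIsoOfFin rfl t : {k : Fin 4 // k ≠ 0})
    have hjJmem : ∀ t, jJ t ∈ P := fun t => (P.orderIsoOfFin rfl t).2
    have hjJinj : Function.Injective jJ := fun t t' h => (P.orderIsoOfFin rfl).injective (Subtype.ext h)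
    have hjJ𝔔 : ∀ t, blowupAlgebra.gen 𝔓 (c 0) (c (jJ t).1) (hc _) ∈ 𝔔 := fun t =>
      (Finset.mem_filter.mp (hjJmem t)).2
    have hjJne1 : ∀ t, jJ t ≠ ⟨1, by decide⟩ := fun t h => by
      simpa [h] using (Finset.mem_filter.mp (hjJmem t)).1
    -- the chart family with `c₁/c₀` in front
    let jJ' : Fin (a + 1) → {k : Fin 4 // k ≠ 0} := Fin.cons ⟨1, by decide⟩ jJ
    have hjJ'inj : Function.Injective jJ' := by
      intro s s' h
      induction s using Fin.cases with
      | zero =>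
        induction s' using Fin.cases with
        | zero => rfl
        | succ t' => exact absurd h (hjJne1 t').symm
      | succ t =>
        induction s' using Fin.cases with
        | zero => exact absurd h (hjJne1 t)
        | succ t' =>
          simp only [jJ', Fin.cons_succ] at h
          rw [hjJinj h]
    have hjJ'𝔔 : ∀ t, blowupAlgebra.gen 𝔓 (c 0) (c (jJ' t).1) (hc _) ∈ 𝔔 := fun t =>
      Fin.cases (by simpa [jJ'] using h1) (fun t => by simpa [jJ'] using hjJ𝔔 t) t
    have hrs' := chartsOverCentre_isRsopPart_chartFamily c 0 w hz hd 𝔓 h𝔓 hc 𝔔 h𝔔 L jJ' hjJ'inj hjJ'𝔔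
    have hcast : a + l + 1 + 1 = a + 1 + l + 1 := by omega
    have hrs'' := hrs'.comp (Fin.cast hcast) (Fin.cast_injective hcast)
    -- `f ≡ c₁/c₀` modulo the rest of the family
    have hK : blowupAlgebra.gen 𝔓 (c 0) (c 2) (hc 2) * blowupAlgebra.gen 𝔓 (c 0) (c 3) (hc 3) * algebraMap R (blowupAlgebra 𝔓 (c 0)) (∏ k ∈ S, w k) ∈ Ideal.ofList (algebraMap R (blowupAlgebra 𝔓 (c 0)) (c 0) ::
        ((List.ofFn fun t => blowupAlgebra.gen 𝔓 (c 0) (c (jJ t).1) (hc _)) ++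
          List.ofFn fun k => algebraMap R (blowupAlgebra 𝔓 (c 0)) (w k))) := by
      rw [Ideal.ofList_cons, Ideal.ofList_append, Ideal.ofList_ofFn, Ideal.ofList_ofFn]
      by_cases h2 : blowupAlgebra.gen 𝔓 (c 0) (c 2) (hc 2) ∈ 𝔔
      · have hm : (⟨2, by decide⟩ : {k : Fin 4 // k ≠ 0}) ∈ P := Finset.mem_filter.mpr ⟨by simp, h2⟩
        obtain ⟨t, ht⟩ := (P.orderIsoOfFin rfl).surjective ⟨_, hm⟩
        have ht' : jJ t = ⟨2, by decide⟩ := congrArg Subtype.val ht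
        refine Ideal.mem_sup_right (Ideal.mem_sup_left ?_)
        rw [mul_assoc]
        refine Ideal.mul_mem_right _ _ (Ideal.subset_span ⟨t, ?_⟩)
        simp only [ht']
      by_cases h3 : blowupAlgebra.gen 𝔓 (c 0) (c 3) (hc 3) ∈ 𝔔
      · have hm : (⟨3, by decide⟩ : {k : Fin 4 // k ≠ 0}) ∈ P := Finset.mem_filter.mpr ⟨by simp, h3⟩
        obtain ⟨t, ht⟩ := (P.orderIsoOfFin rfl).surjective ⟨_, hm⟩
        have ht' : jJ t = ⟨3, by decide⟩ := congrArg Subtype.val ht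
        refine Ideal.mem_sup_right (Ideal.mem_sup_left ?_)
        rw [mul_comm (blowupAlgebra.gen 𝔓 (c 0) (c 2) (hc 2)), mul_assoc]
        refine Ideal.mul_mem_right _ _ (Ideal.subset_span ⟨t, ?_⟩)
        simp only [ht']
      by_cases hS : S = ∅
      · exfalso
        have hH1 : algebraMap R (blowupAlgebra 𝔓 (c 0)) (∏ k ∈ S, w k) = 1 := by rw [hS, Finset.prod_empty, map_one]
        have : blowupAlgebra.gen 𝔓 (c 0) (c 2) (hc 2) * blowupAlgebra.gen 𝔓 (c 0) (c 3) (hc 3) ∈ 𝔔 := by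
          have h := 𝔔.sub_mem h1 hf
          rw [he0, hH1, one_mul, mul_one, sub_sub_cancel] at h
          exact h
        rcases Ideal.IsPrime.mem_or_mem inferInstance this with h | h
        · exact h2 h
        · exact h3 h
      · obtain ⟨k, hk⟩ := Finset.nonempty_iff_ne_empty.mpr hS
        obtain ⟨q, hq⟩ : w k ∣ (∏ k ∈ S, w k) := Finset.dvd_prod_of_mem _ hk
        refine Ideal.mem_sup_right (Ideal.mem_sup_right ?_)
        rw [hq, map_mul, show blowupAlgebra.gen 𝔓 (c 0) (c 2) (hc 2) * blowupAlgebra.gen 𝔓 (c 0) (c 3) (hc 3) * (algebraMap R (blowupAlgebra 𝔓 (c 0)) (w k) * algebraMap R (blowupAlgebra 𝔓 (c 0)) q) = blowupAlgebra.gen 𝔓 (c 0) (c 2) (hc 2) * blowupAlgebra.gen 𝔓 (c 0) (c 3) (hc 3) * algebraMap R (blowupAlgebra 𝔓 (c 0)) q * algebraMap R (blowupAlgebra 𝔓 (c 0)) (w k) by ring]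
        exact Ideal.mul_mem_left _ _ (Ideal.subset_span ⟨k, rfl⟩)
    have hdiff : algebraMap (blowupAlgebra 𝔓 (c 0)) L (blowupAlgebra.gen 𝔓 (c 0) (c 0) (hc 0) * blowupAlgebra.gen 𝔓 (c 0) (c 1) (hc 1) - blowupAlgebra.gen 𝔓 (c 0) (c 2) (hc 2) * blowupAlgebra.gen 𝔓 (c 0) (c 3) (hc 3) * algebraMap R (blowupAlgebra 𝔓 (c 0)) (∏ k ∈ S, w k)) - algebraMap (blowupAlgebra 𝔓 (c 0)) L (blowupAlgebra.gen 𝔓 (c 0) (c 1) (hc 1)) ∈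
        (Ideal.ofList (algebraMap R (blowupAlgebra 𝔓 (c 0)) (c 0) ::
          ((List.ofFn fun t => blowupAlgebra.gen 𝔓 (c 0) (c (jJ t).1) (hc _)) ++
            List.ofFn fun k => algebraMap R (blowupAlgebra 𝔓 (c 0)) (w k)))).map (algebraMap (blowupAlgebra 𝔓 (c 0)) L) := by
      rw [he0, one_mul, map_sub, sub_sub_cancel_left, neg_mem_iff]
      exact Ideal.mem_map_of_mem _ hK
    have hspan : Ideal.span (Set.range (Fin.cons (algebraMap (blowupAlgebra 𝔓 (c 0)) L (blowupAlgebra.gen 𝔓 (c 0) (c 0) (hc 0) * blowupAlgebra.gen 𝔓 (c 0) (c 1) (hc 1) - blowupAlgebra.gen 𝔓 (c 0) (c 2) (hc 2) * blowupAlgebra.gen 𝔓 (c 0) (c 3) (hc 3) * algebraMap R (blowupAlgebra 𝔓 (c 0)) (∏ k ∈ S, w k)))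
        (chartFamily c 0 w L (algebraMap R (blowupAlgebra 𝔓 (c 0))) (fun k => blowupAlgebra.gen 𝔓 (c 0) (c k) (hc k)) jJ) :
          Fin (a + l + 1 + 1) → L)) =
        Ideal.span (Set.range (chartFamily c 0 w L (algebraMap R (blowupAlgebra 𝔓 (c 0))) (fun k => blowupAlgebra.gen 𝔓 (c 0) (c k) (hc k)) jJ' ∘
          Fin.cast hcast)) := by
      have hsurj : Function.Surjective (Fin.cast hcast) := fun i => ⟨Fin.cast hcast.symm i, rfl⟩
      have hR : Set.range (chartFamily c 0 w L (algebraMap R (blowupAlgebra 𝔓 (c 0))) (fun k => blowupAlgebra.gen 𝔓 (c 0) (c k) (hc k)) jJ' ∘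
          Fin.cast hcast) =
          Set.range (chartFamily c 0 w L (algebraMap R (blowupAlgebra 𝔓 (c 0))) (fun k => blowupAlgebra.gen 𝔓 (c 0) (c k) (hc k)) jJ') :=
        hsurj.range_comp _
      have hofFn : (List.ofFn fun t => blowupAlgebra.gen 𝔓 (c 0) (c (jJ' t).1) (hc _)) =
          blowupAlgebra.gen 𝔓 (c 0) (c 1) (hc 1) :: List.ofFn fun t => blowupAlgebra.gen 𝔓 (c 0) (c (jJ t).1) (hc _) := by
        rw [List.ofFn_succ]
        rfl
      rw [hR, Fin.range_cons, Ideal.span_insert, span_range_chartFamily, span_range_chartFamily,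
        chartsOverCentre_span_singleton_sup_eq_of_sub_mem hdiff, hofFn]
      simp only [Ideal.ofList_cons, Ideal.ofList_append, Ideal.map_sup, List.cons_append,
        Ideal.map_span, Set.image_singleton]
      ac_rfl
    refine ⟨a, jJ, Fin.cons 2 (Fin.append (fun _ => 1) fun k => if k ∈ T then 1 else 0),
      (if blowupAlgebra.gen 𝔓 (c 0) (c 2) (hc 2) ∈ 𝔔 then 1 else algebraMap (blowupAlgebra 𝔓 (c 0)) L (blowupAlgebra.gen 𝔓 (c 0) (c 2) (hc 2))) * (if blowupAlgebra.gen 𝔓 (c 0) (c 3) (hc 3) ∈ 𝔔 then 1 else algebraMap (blowupAlgebra 𝔓 (c 0)) L (blowupAlgebra.gen 𝔓 (c 0) (c 3) (hc 3))),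
      chartsOverCentre_isRsopPart_of_span_eq hrs'' hspan, rfl, fun i hi => ?_, ?_, ?_⟩
    · obtain ⟨i, rfl⟩ := Fin.exists_succ_eq.mpr hi
      rw [Fin.cons_succ]
      refine Fin.addCases (fun t => ?_) (fun k => ?_) i
      · rw [Fin.append_left]
      · rw [Fin.append_right]
        split_ifs <;> omega
    · refine IsUnit.mul ?_ ?_
      · split_ifs with h
        · exact isUnit_one
        · exact hunit 2 h
      · split_ifs with h
        · exact isUnit_one
        · exact hunit 3 h
    · rw [hprodZ, hJL]
      simp only [pow_one]
      -- `∏ t, c_{jJ t}/c₀ = ∏_{m ∈ P} c_m/c₀`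
      have hprodP : ∏ t, algebraMap (blowupAlgebra 𝔓 (c 0)) L (blowupAlgebra.gen 𝔓 (c 0) (c (jJ t).1) (hc _)) =
          (if blowupAlgebra.gen 𝔓 (c 0) (c 2) (hc 2) ∈ 𝔔 then algebraMap (blowupAlgebra 𝔓 (c 0)) L (blowupAlgebra.gen 𝔓 (c 0) (c 2) (hc 2)) else 1) * (if blowupAlgebra.gen 𝔓 (c 0) (c 3) (hc 3) ∈ 𝔔 then algebraMap (blowupAlgebra 𝔓 (c 0)) L (blowupAlgebra.gen 𝔓 (c 0) (c 3) (hc 3)) else 1) := by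
        have h1' : ∏ t, algebraMap (blowupAlgebra 𝔓 (c 0)) L (blowupAlgebra.gen 𝔓 (c 0) (c (jJ t).1) (hc _)) =
            ∏ m ∈ P, algebraMap (blowupAlgebra 𝔓 (c 0)) L (blowupAlgebra.gen 𝔓 (c 0) (c m.1) (hc _)) := by
          rw [← Finset.prod_coe_sort P]
          exact Fintype.prod_equiv (P.orderIsoOfFin rfl).toEquiv _ _ fun t => rfl
        rw [h1', hP, Finset.prod_filter, Finset.prod_pair (by decide)]
      rw [hprodP]
      rw [show algebraMap (blowupAlgebra 𝔓 (c 0)) L (algebraMap R (blowupAlgebra 𝔓 (c 0)) (c 0)) ^ 2 * algebraMap (blowupAlgebra 𝔓 (c 0)) L (blowupAlgebra.gen 𝔓 (c 0) (c 2) (hc 2)) * algebraMap (blowupAlgebra 𝔓 (c 0)) L (blowupAlgebra.gen 𝔓 (c 0) (c 3) (hc 3)) * ∏ k ∈ T, algebraMap (blowupAlgebra 𝔓 (c 0)) L (algebraMap R (blowupAlgebra 𝔓 (c 0)) (w k)) -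
          (if blowupAlgebra.gen 𝔓 (c 0) (c 2) (hc 2) ∈ 𝔔 then 1 else algebraMap (blowupAlgebra 𝔓 (c 0)) L (blowupAlgebra.gen 𝔓 (c 0) (c 2) (hc 2))) * (if blowupAlgebra.gen 𝔓 (c 0) (c 3) (hc 3) ∈ 𝔔 then 1 else algebraMap (blowupAlgebra 𝔓 (c 0)) L (blowupAlgebra.gen 𝔓 (c 0) (c 3) (hc 3))) *
            (algebraMap (blowupAlgebra 𝔓 (c 0)) L (algebraMap R (blowupAlgebra 𝔓 (c 0)) (c 0)) ^ 2 *
              ((if blowupAlgebra.gen 𝔓 (c 0) (c 2) (hc 2) ∈ 𝔔 then algebraMap (blowupAlgebra 𝔓 (c 0)) L (blowupAlgebra.gen 𝔓 (c 0) (c 2) (hc 2)) else 1) * (if blowupAlgebra.gen 𝔓 (c 0) (c 3) (hc 3) ∈ 𝔔 then algebraMap (blowupAlgebra 𝔓 (c 0)) L (blowupAlgebra.gen 𝔓 (c 0) (c 3) (hc 3)) else 1)) *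
              ∏ k ∈ T, algebraMap (blowupAlgebra 𝔓 (c 0)) L (algebraMap R (blowupAlgebra 𝔓 (c 0)) (w k))) = 0 by split_ifs <;> ring]
      exact Ideal.zero_mem _


/-- **The regular case from a marked family, general positions**: `Z₁, …, Z_N` part of a regular
system of parameters of `L` with the strict transform `f = Z_{i_f}` and the exceptional generator
`G = Z_{i₀}` among them (`i_f ≠ i₀`), exponents `a` with `a i₀ = 2`, `a i_f = 0`, `a i ≤ 1`
otherwise, and `J ≡ U ∏ Zᵢ^{aᵢ}` modulo `f` with `U` a unit. Then in `O = L/(f)` (regular): `Ḡ`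
is a non-zero-divisor and there is `w` with `(J̄) = (Ḡ² w)`, `√((J̄) Ô) = (Ḡ w) Ô` and `(Ḡ w)`
having local strict normal crossings data (`chartsOverCentre_regularCase` for the sub-family
`(f, G, (Zᵢ)_{aᵢ = 1})`). [cite: DeJong1996, 4.27, p. 76] -/
theorem chartsOverCentre_regularCase'' {L : Type} [CommRing L] [IsLocalRing L] {N : ℕ}
    {Z : Fin N → L} {U J : L} (hrs : IsRsopPart Z) (i_f i₀ : Fin N) (hne : i_f ≠ i₀)
    (a : Fin N → ℕ) (ha₀ : a i₀ = 2) (haf : a i_f = 0) (ha : ∀ i, i ≠ i₀ → a i ≤ 1)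
    (hU : IsUnit U) (hJ : J - U * ∏ i, Z i ^ a i ∈ Ideal.span {Z i_f})
    [IsLocalRing (L ⧸ Ideal.span {Z i_f})] :
    IsRegularLocalRing (L ⧸ Ideal.span {Z i_f}) ∧
    Ideal.Quotient.mk (Ideal.span {Z i_f}) (Z i₀) ∈ nonZeroDivisors (L ⧸ Ideal.span {Z i_f}) ∧
    ∃ w : L ⧸ Ideal.span {Z i_f},
      Ideal.span {Ideal.Quotient.mk (Ideal.span {Z i_f}) J} =
        Ideal.span {Ideal.Quotient.mk (Ideal.span {Z i_f}) (Z i₀) ^ 2 * w} ∧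
      ((Ideal.span {Ideal.Quotient.mk (Ideal.span {Z i_f}) J}).map
          (algebraMap (L ⧸ Ideal.span {Z i_f}) (AdicCompletion (maximalIdeal (L ⧸ Ideal.span {Z i_f}))
            (L ⧸ Ideal.span {Z i_f})))).radical =
        (Ideal.span {Ideal.Quotient.mk (Ideal.span {Z i_f}) (Z i₀) * w}).map
          (algebraMap (L ⧸ Ideal.span {Z i_f}) (AdicCompletion (maximalIdeal (L ⧸ Ideal.span {Z i_f}))
            (L ⧸ Ideal.span {Z i_f}))) ∧
      IsSNCIdeal (Ideal.span {Ideal.Quotient.mk (Ideal.span {Z i_f}) (Z i₀) * w}) := by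
  classical
  -- the indices with exponent one, enumerated
  set P : Finset (Fin N) := Finset.univ.filter fun i => i ≠ i₀ ∧ a i = 1 with hP
  set n := P.card with hn
  let σ : Fin n → Fin N := fun t => (P.orderIsoOfFin rfl t : Fin N)
  have hσmem : ∀ t, σ t ∈ P := fun t => (P.orderIsoOfFin rfl t).2
  have hσinj : Function.Injective σ := fun t t' h =>
    (P.orderIsoOfFin rfl).injective (Subtype.ext h)
  have hσne : ∀ t, σ t ≠ i₀ := fun t => ((Finset.mem_filter.mp (hσmem t)).2).1
  have hσnef : ∀ t, σ t ≠ i_f := fun t h => by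
    have := ((Finset.mem_filter.mp (hσmem t)).2).2
    rw [h, haf] at this
    exact zero_ne_one this
  -- the sub-family `(f, Z i₀, Z ∘ σ)`
  let ι : Fin (n + 1 + 1) → Fin N := Fin.cons i_f (Fin.cons i₀ σ)
  have hιinj : Function.Injective ι := by
    intro s s' h
    induction s using Fin.cases with
    | zero =>
      induction s' using Fin.cases with
      | zero => rfl
      | succ s' =>
        induction s' using Fin.cases with
        | zero => exact absurd h hne
        | succ t' => exact absurd h.symm (hσnef t')
    | succ s =>
      induction s' using Fin.cases with
      | zero =>
        induction s using Fin.cases with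
        | zero => exact absurd h.symm hne
        | succ t => exact absurd h (hσnef t)
      | succ s' =>
        induction s using Fin.cases with
        | zero =>
          induction s' using Fin.cases with
          | zero => rfl
          | succ t' => exact absurd h.symm (hσne t')
        | succ t =>
          induction s' using Fin.cases with
          | zero => exact absurd h (hσne t)
          | succ t' =>
            simp only [ι, Fin.cons_succ] at h
            rw [hσinj h]
  have hsub : Z ∘ ι = (Fin.cons (Z i_f) (Fin.cons (Z i₀) (Z ∘ σ)) : Fin (n + 1 + 1) → L) := by
    funext s
    refine Fin.cases ?_ (fun s => Fin.cases ?_ (fun t => ?_) s) s <;> simp [ι]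
  have hrs' : IsRsopPart (Fin.cons (Z i_f) (Fin.cons (Z i₀) (Z ∘ σ)) : Fin (n + 1 + 1) → L) := by
    rw [← hsub]
    exact hrs.comp ι hιinj
  -- the product `∏ Zᵢ^{aᵢ} = Z_{i₀}² · ∏ (Z ∘ σ)`
  have hprod : ∏ i, Z i ^ a i = Z i₀ ^ 2 * ∏ t, (Z ∘ σ) t := by
    have h1 : ∏ i, Z i ^ a i = ∏ i ∈ insert i₀ P, Z i ^ a i := by
      refine (Finset.prod_subset (Finset.subset_univ _) fun i _ hi => ?_).symm
      have hi0 : i ≠ i₀ := fun h => hi (h ▸ Finset.mem_insert_self _ _)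
      have hai : a i = 0 := by
        have := ha i hi0
        have hne : a i ≠ 1 := fun h1 => hi (Finset.mem_insert_of_mem (Finset.mem_filter.mpr
          ⟨Finset.mem_univ _, hi0, h1⟩))
        omega
      rw [hai, pow_zero]
    have hi0P : i₀ ∉ P := fun h => ((Finset.mem_filter.mp h).2).1 rfl
    rw [h1, Finset.prod_insert hi0P, ha₀]
    congr 1
    have h2 : ∏ i ∈ P, Z i ^ a i = ∏ i ∈ P, Z i :=
      Finset.prod_congr rfl fun i hi => by rw [((Finset.mem_filter.mp hi).2).2, pow_one]
    rw [h2]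
    have h3 : ∏ t : Fin n, (Z ∘ σ) t = ∏ i ∈ Finset.univ.map ⟨σ, hσinj⟩, Z i := by
      rw [Finset.prod_map]
      rfl
    rw [h3]
    congr 1
    ext i
    simp only [Finset.mem_map, Finset.mem_univ, Function.Embedding.coeFn_mk, true_and]
    constructor
    · intro hi
      obtain ⟨t, ht⟩ := (P.orderIsoOfFin rfl).surjective ⟨i, hi⟩
      exact ⟨t, congrArg Subtype.val ht⟩
    · rintro ⟨t, rfl⟩
      exact hσmem t
  rw [hprod, ← mul_assoc] at hJ
  obtain ⟨hreg, hnzd, hspan, hrad, hsnc⟩ := chartsOverCentre_regularCase hrs' hU hJ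
  exact ⟨hreg, hnzd, _, hspan, hrad, hsnc⟩


end Summit.ResolutionOfSingularities.ResolutionOfSingularities.Theorems

end
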